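import Summits.NavierStokesRegularity.NavierStokesRegularity.Theorems.AdaptedFrequencyFrequencyRigidityFiniteRSSExtremes
import Summits.NavierStokesRegularity.NavierStokesRegularity.Theorems.AdaptedFrequencyFrequencyRigidityRSSViscosityNormalisation
import Summits.NavierStokesRegularity.NavierStokesRegularity.Theorems.AdaptedFrequencyFrequencyRigidityViscosityNormalisation
import Literature.Analysis.FluidPDE.EulerTimeScaling
import HarnessLib

/-!
# Crux `FrequencyRigidity` (stmt-NavierStokesRegularity-2955), line `scaled-energy-split`:
# RSS witnesses of Stub 2 live on Pineau–Vicol's window — any viscosity, uniform thresholds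

Helper file (`--supports stmt-NavierStokesRegularity-2955`; theorems only, sorry-free).  Stub
`stub_rssWitnessWindow` (sub-goal (G) of Stub 2): for every viscosity `ν > 0` and decay constant
`C₀ > 0` there are thresholds `0 < α₁, α₂` (Pineau–Vicol 2026 Thm 1.4 for the normalised decay
constant `C₀((√ν)⁻¹ + ν⁻¹)`) such that every classical viscosity-`ν` Navier–Stokes flow on
`(−∞, 0)` of rotated self-similar form `v = pvAnsatz α U` with `‖U(y)‖ ≤ C₀/(1 + ‖y‖)` and a
weight `K` with positive weighted enstrophy `∫‖curl v(t)‖² K(t) > 0` has `α₁ ≤ |α| ≤ α₂`.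
Together with sub-goal (H) (`stub_rssWitnessDecays`: every RSS witness of the finite piece has
SOME decay constant) this is the precise sense in which the rotated-self-similar content of Stub 2
is Pineau–Vicol's Conjecture 1.1 ON ITS WINDOW.

Proof.  Normalise the viscosity (`u(t,x) = ν⁻¹ v(ν⁻¹t, x)`, `classical_viscosity`): `u` is RSS with
profile `Ũ(y) = (√ν)⁻¹ R(α log ν) U(√ν R(−α log ν) y)` (`stub_rssViscosityNormalisation`), whose
decay constant is at most `C₀((√ν)⁻¹ + ν⁻¹)`; the weight `K(ν⁻¹t, ·)` has positive weighted
enstrophy for `u` (`curl (ν⁻¹ v) = ν⁻¹ curl v`); apply sub-goal (B) (`stub_finiteRSSExtremes`).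

## References

* B. Pineau, V. Vicol, arXiv:2607.09619 (2026), Theorem 1.4, Remark 1.2. [PineauVicol2026]
-/

noncomputable section

set_option linter.dupNamespace false

namespace Summit.NavierStokesRegularity.NavierStokesRegularity.Theorems.FrequencyRigidity.ScaledEnergySplit

open Literature.Analysis.FluidPDE MeasureTheory Set Function Metric Filter Topology

/-- **Decay of the normalised profile.**  If `‖U(z)‖ ≤ C₀/(1 + ‖z‖)` then
`Ũ(y) = (√ν)⁻¹ R(c) U(√ν R(−c) y)` satisfies `‖Ũ(y)‖ ≤ C₀((√ν)⁻¹ + ν⁻¹)/(1 + ‖y‖)`. [folklore] -/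
theorem rssWindow_decay_normalised {ν c C₀ : ℝ} (hν : 0 < ν)
    {U : EuclideanSpace ℝ (Fin 3) → EuclideanSpace ℝ (Fin 3)} (h : ∀ z, ‖U z‖ ≤ C₀ / (1 + ‖z‖)) :
    ∀ y, ‖(Real.sqrt ν)⁻¹ • rotZ c (U (Real.sqrt ν • rotZ (-c) y))‖ ≤
      C₀ * ((Real.sqrt ν)⁻¹ + ν⁻¹) / (1 + ‖y‖) := by
  intro y
  have ha : 0 < Real.sqrt ν := Real.sqrt_pos.2 hν
  have haa : Real.sqrt ν * Real.sqrt ν = ν := Real.mul_self_sqrt hν.le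
  have hC : 0 ≤ C₀ := by
    have h0 := (norm_nonneg _).trans (h 0)
    simpa using h0
  rw [norm_smul, norm_inv, Real.norm_of_nonneg ha.le, norm_rotZ]
  have h1 := h (Real.sqrt ν • rotZ (-c) y)
  rw [norm_smul, Real.norm_of_nonneg ha.le, norm_rotZ] at h1
  -- `h1 : ‖U _‖ ≤ C₀ / (1 + √ν ‖y‖)`
  rw [le_div_iff₀ (by positivity)]
  rw [le_div_iff₀ (by positivity)] at h1
  have hinv : (Real.sqrt ν)⁻¹ * Real.sqrt ν = 1 := inv_mul_cancel₀ ha.ne'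
  have hinv2 : ν⁻¹ * ν = 1 := inv_mul_cancel₀ hν.ne'
  -- `(√ν)⁻¹ ‖U‖ (1 + ‖y‖) ≤ C₀ ((√ν)⁻¹ + ν⁻¹)`
  have key : (Real.sqrt ν)⁻¹ * (1 + ‖y‖) ≤ ((Real.sqrt ν)⁻¹ + ν⁻¹) * (1 + Real.sqrt ν * ‖y‖) := by
    have e1 : (Real.sqrt ν)⁻¹ * ‖y‖ = ν⁻¹ * (Real.sqrt ν * ‖y‖) := by
      rw [← mul_assoc]
      congr 1
      field_simp
      rw [sq]
      exact haa.symm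
    nlinarith [inv_nonneg.2 ha.le, inv_nonneg.2 hν.le, norm_nonneg y,
      mul_nonneg (inv_nonneg.2 ha.le) (mul_nonneg ha.le (norm_nonneg y)),
      mul_nonneg (inv_nonneg.2 hν.le) (norm_nonneg y)]
  calc (Real.sqrt ν)⁻¹ * ‖U (Real.sqrt ν • rotZ (-c) y)‖ * (1 + ‖y‖)
      = ‖U (Real.sqrt ν • rotZ (-c) y)‖ * ((Real.sqrt ν)⁻¹ * (1 + ‖y‖)) := by ring
    _ ≤ ‖U (Real.sqrt ν • rotZ (-c) y)‖ * (((Real.sqrt ν)⁻¹ + ν⁻¹) * (1 + Real.sqrt ν * ‖y‖)) :=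
        mul_le_mul_of_nonneg_left key (norm_nonneg _)
    _ = ‖U (Real.sqrt ν • rotZ (-c) y)‖ * (1 + Real.sqrt ν * ‖y‖) * ((Real.sqrt ν)⁻¹ + ν⁻¹) := by ring
    _ ≤ C₀ * ((Real.sqrt ν)⁻¹ + ν⁻¹) := mul_le_mul_of_nonneg_right h1 (by positivity)

/-- **Positive weighted enstrophy survives the viscosity normalisation**: with the weight `K(ν⁻¹ t, ·)`,
`∫ ‖curl (ν⁻¹ v(ν⁻¹t))‖² K(ν⁻¹t) = ν⁻² ∫ ‖curl v(ν⁻¹t)‖² K(ν⁻¹t) > 0`. [folklore] -/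
theorem rssWindow_enstrophy_pos {ν : ℝ} (hν : 0 < ν)
    {v : ℝ → EuclideanSpace ℝ (Fin 3) → EuclideanSpace ℝ (Fin 3)}
    {K : ℝ → EuclideanSpace ℝ (Fin 3) → ℝ}
    (hH : ∀ t ∈ Iio (0:ℝ), 0 < ∫ x, ‖curl (v t) x‖ ^ 2 * K t x) :
    ∀ t ∈ Iio (0:ℝ), 0 < ∫ x, ‖curl ((fun t x => ν⁻¹ • v (ν⁻¹ * t) x) t) x‖ ^ 2 * K (ν⁻¹ * t) x := by
  intro t ht
  have ht' : ν⁻¹ * t ∈ Iio (0:ℝ) := mul_neg_of_pos_of_neg (inv_pos.2 hν) ht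
  have e : (fun x => ‖curl ((fun t x => ν⁻¹ • v (ν⁻¹ * t) x) t) x‖ ^ 2 * K (ν⁻¹ * t) x) =
      fun x => (ν⁻¹) ^ 2 * (‖curl (v (ν⁻¹ * t)) x‖ ^ 2 * K (ν⁻¹ * t) x) := by
    funext x
    have hc : curl ((fun t x => ν⁻¹ • v (ν⁻¹ * t) x) t) x = ν⁻¹ • curl (v (ν⁻¹ * t)) x :=
      curl_const_smul_field ν⁻¹ (v (ν⁻¹ * t)) x
    rw [hc, norm_smul, norm_inv, Real.norm_of_nonneg hν.le, mul_pow]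
    ring
  rw [e, integral_const_mul]
  exact mul_pos (by positivity) (hH _ ht')

/-- **Sub-goal (G) of Stub 2 of line `scaled-energy-split` — RSS witnesses lie on Pineau–Vicol's window,
any viscosity, thresholds uniform in the decay constant.**  For every `ν > 0`, `C₀ > 0` there are
`α₁, α₂ > 0` such that every classical viscosity-`ν` Navier–Stokes flow on `(−∞,0)` of rotated self-similar
form `v = pvAnsatz α U` with `‖U(y)‖ ≤ C₀/(1 + ‖y‖)` and a weight with positive weighted enstrophy has
`α₁ ≤ |α| ≤ α₂` (Pineau–Vicol 2026 Thm 1.4 for the viscosity-normalised flow).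
[cite: PineauVicol2026, Theorem 1.4 (arXiv:2607.09619 p. 4)] -/
theorem stub_rssWitnessWindow : ∀ (ν C₀ : ℝ), 0 < ν → 0 < C₀ → ∃ α₁ α₂ : ℝ, 0 < α₁ ∧ 0 < α₂ ∧ ∀ (α : ℝ) (U : EuclideanSpace ℝ (Fin 3) → EuclideanSpace ℝ (Fin 3)) (v : ℝ → EuclideanSpace ℝ (Fin 3) → EuclideanSpace ℝ (Fin 3)) (q : ℝ → EuclideanSpace ℝ (Fin 3) → ℝ) (K : ℝ → EuclideanSpace ℝ (Fin 3) → ℝ), Literature.Analysis.FluidPDE.IsClassicalNSSolutionOn (Set.Iio 0) ν 0 v q → (∀ t ∈ Set.Iio (0:ℝ), ∀ x, v t x = Literature.Analysis.FluidPDE.pvAnsatz α (fun y _ => U y) t x) → (∀ y, ‖U y‖ ≤ C₀ / (1 + ‖y‖)) → (∀ t ∈ Set.Iio (0:ℝ), 0 < ∫ x, ‖Literature.Analysis.FluidPDE.curl (v t) x‖ ^ 2 * K t x) → α₁ ≤ |α| ∧ |α| ≤ α₂ := by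
  intro ν C₀ hν hC₀
  obtain ⟨α₁, α₂, hα₁, hα₂, hB⟩ := stub_finiteRSSExtremes (C₀ * ((Real.sqrt ν)⁻¹ + ν⁻¹)) (by positivity)
  refine ⟨α₁, α₂, hα₁, hα₂, fun α U v q K hsol hA hdec hH => ?_⟩
  have hcl := classical_viscosity hν hsol
  rw [visc_velocity_eq, visc_pressure_eq] at hcl
  have hAu := stub_rssViscosityNormalisation ν α U v hν hA
  have hdec' := rssWindow_decay_normalised (c := α * Real.log ν) hν hdec
  have hH' := rssWindow_enstrophy_pos hν hH (K := K)
  have hB' := hB α _ (fun t x => ν⁻¹ • v (ν⁻¹ * t) x) (fun t x => (ν⁻¹) ^ 2 * q (ν⁻¹ * t) x)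
    (fun t x => K (ν⁻¹ * t) x) hcl hAu hdec' hH'
  constructor
  · by_contra hlt
    exact hB' (Or.inl (lt_of_not_ge hlt))
  · by_contra hlt
    exact hB' (Or.inr (lt_of_not_ge hlt))

end Summit.NavierStokesRegularity.NavierStokesRegularity.Theorems.FrequencyRigidity.ScaledEnergySplit

end
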